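import Summits.KontsevichZagierPeriods.KontsevichZagierPeriods.Theses.ComplexOrientations
import Literature.NumberTheory.Transcendental.KZCalculusProofs
import Literature.NumberTheory.Transcendental.KZSemiCanonicalReductionHolds
import Literature.NumberTheory.Transcendental.KZSemiCanonicalReductionProofs

/-!
# Crux `OrientationKernel` (stmt-KontsevichZagierPeriods-11367), line `birth`: stub `stub_sectorMerge`

Bookkeeping inside the **1-period sector** of the Kontsevich–Zagier calculus of moves
(`Literature.NumberTheory.Transcendental.KZ`): the additive subgroup of `KZ.FormalRep` generated by

* all representations of dimension `0`,
* all representations of dimension `1`,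
* the planar (dimension-`2`) representations with bounded domain and integrand `1` on it,

consists, modulo `KZ.relations`, of differences `[A] − [B]` of two BOUNDED planar representations
with integrand `1` (two bounded `ℚ`-semialgebraic planar sets).

Proof by `AddSubgroup.closure_induction`, using only tools already in the tree:

* `0 ≡ [∅] − [∅]` (`KZ.IntegralRep.of_empty_mem_relations`);
* a planar generator `s`: `[s] ≡ [s] − [∅]`;
* a generator of dimension `1`: split by sign, `[s] ≡ [p] − [q]` with non-negative integrands
  (`KZ.exists_sub_add_mem_relations_sign`), and each non-negative integrand is one bounded volume
  one dimension up (`KZ.exists_boundedVolume_sub_mem_relations`: region under the graph, grounding,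
  monomial compression);
* a generator of dimension `0`: the same, with `KZ.exists_boundedVolume_sub_mem_relations` applied
  twice (`0 ↦ 1 ↦ 2`; the intermediate integrand is `1 ≥ 0`);
* negation swaps `A` and `B`;
* addition merges the two `A`'s and the two `B`'s by a disjoint rational translate glued by domain
  additivity (`KZ.exists_merge₂`).

No transcendence content; no definitions are introduced.

References: M. Kontsevich, D. Zagier, *Periods* (2001), §1.2, rules (1)–(3); J. Viu-Sos,
*A semi-canonical reduction for periods of Kontsevich–Zagier*, Int. J. Number Theory 17 (2021),
Cor. 2.3.
-/

noncomputable section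

open Literature.NumberTheory.Transcendental

namespace Summit.KontsevichZagierPeriods.ComplexOrientations.OrientationKernel

/-- A representation of dimension `1` with non-negative integrand is, modulo the moves, one bounded
planar representation with integrand `1` (`KZ.exists_boundedVolume_sub_mem_relations` at `n = 1`).
[folklore; Viu-Sos 2021, Cor. 2.3] -/
theorem exists_planar_sub_mem_relations_one (p : KZ.IntegralRep 1)
    (hp : ∀ x ∈ p.domain, 0 ≤ p.integrand x) :
    ∃ B : KZ.IntegralRep 2, Bornology.IsBounded B.domain ∧ (∀ z ∈ B.domain, B.integrand z = 1) ∧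
      KZ.of p - KZ.of B ∈ KZ.relations :=
  KZ.exists_boundedVolume_sub_mem_relations p hp

/-- A representation of dimension `0` with non-negative integrand is, modulo the moves, one bounded
planar representation with integrand `1`: `KZ.exists_boundedVolume_sub_mem_relations` twice, the
intermediate (dimension-`1`) integrand being `1 ≥ 0` on its domain. [folklore] -/
theorem exists_planar_sub_mem_relations_zero (p : KZ.IntegralRep 0)
    (hp : ∀ x ∈ p.domain, 0 ≤ p.integrand x) :
    ∃ B : KZ.IntegralRep 2, Bornology.IsBounded B.domain ∧ (∀ z ∈ B.domain, B.integrand z = 1) ∧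
      KZ.of p - KZ.of B ∈ KZ.relations := by
  obtain ⟨B₁, -, hB₁1, e₁⟩ := KZ.exists_boundedVolume_sub_mem_relations p hp
  obtain ⟨B, hBb, hB1, e⟩ := KZ.exists_boundedVolume_sub_mem_relations B₁
    (fun z hz => by rw [hB₁1 z hz]; exact zero_le_one)
  refine ⟨B, hBb, hB1, ?_⟩
  have : KZ.of p - KZ.of B = (KZ.of p - KZ.of B₁) + (KZ.of B₁ - KZ.of B) := by abel
  rw [this]
  exact KZ.relations.add_mem e₁ e

/-- **Sign splitting into a planar pair.** If every representation of dimension `n` with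
non-negative integrand is, modulo the moves, one bounded planar representation with integrand `1`,
then every representation `r` of dimension `n` is `≡ [A] − [B]` with `A`, `B` bounded planar
representations with integrand `1`: split `[r] ≡ [p] − [q]` by sign
(`KZ.exists_sub_add_mem_relations_sign`) and convert `p` and `q`. [folklore; Viu-Sos 2021, Cor. 2.3] -/
theorem exists_planarPair_of_sign {n : ℕ} (r : KZ.IntegralRep n)
    (H : ∀ p : KZ.IntegralRep n, (∀ x ∈ p.domain, 0 ≤ p.integrand x) →
      ∃ B : KZ.IntegralRep 2, Bornology.IsBounded B.domain ∧ (∀ z ∈ B.domain, B.integrand z = 1) ∧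
        KZ.of p - KZ.of B ∈ KZ.relations) :
    ∃ A B : KZ.IntegralRep 2, Bornology.IsBounded A.domain ∧ Bornology.IsBounded B.domain ∧
      (∀ v ∈ A.domain, A.integrand v = 1) ∧ (∀ v ∈ B.domain, B.integrand v = 1) ∧
      KZ.of r - (KZ.of A - KZ.of B) ∈ KZ.relations := by
  obtain ⟨p, q, hp, hq, hpq⟩ := KZ.exists_sub_add_mem_relations_sign r
  obtain ⟨A, hAb, hA1, hA⟩ := H p hp
  obtain ⟨B, hBb, hB1, hB⟩ := H q hq
  refine ⟨A, B, hAb, hBb, hA1, hB1, ?_⟩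
  have : KZ.of r - (KZ.of A - KZ.of B) =
      (KZ.of r - KZ.of p + KZ.of q) + (KZ.of p - KZ.of A) - (KZ.of q - KZ.of B) := by
    abel
  rw [this]
  exact KZ.relations.sub_mem (KZ.relations.add_mem hpq hA) hB

/-- **Stub `stub_sectorMerge` — merging inside the 1-period sector.** Every element of the
subgroup of `KZ.FormalRep` generated by the representations of dimension `0`, the representations
of dimension `1` and the bounded planar representations with integrand `1` is congruent, modulo
`KZ.relations`, to a difference `[A] − [B]` of two bounded planar representations with integrand
`1`. `AddSubgroup.closure_induction`: `0 ≡ [∅] − [∅]`; planar generators `[s] ≡ [s] − [∅]`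
(`KZ.IntegralRep.of_empty_mem_relations`); generators of dimension `1` / `0` by sign splitting and
`KZ.exists_boundedVolume_sub_mem_relations` (once / twice); negation swaps; addition merges the
`A`'s and the `B`'s by disjoint rational translates (`KZ.exists_merge₂`). [folklore;
Kontsevich–Zagier 2001, §1.2, rules (1)–(3); Viu-Sos 2021, Cor. 2.3] -/
theorem stub_sectorMerge :
    ∀ y ∈ AddSubgroup.closure
        ({c : KZ.FormalRep | ∃ s : KZ.IntegralRep 0, c = KZ.of s} ∪
          {c : KZ.FormalRep | ∃ s : KZ.IntegralRep 1, c = KZ.of s} ∪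
          {c : KZ.FormalRep | ∃ s : KZ.IntegralRep 2, Bornology.IsBounded s.domain ∧
            (∀ v ∈ s.domain, s.integrand v = 1) ∧ c = KZ.of s}),
      ∃ A B : KZ.IntegralRep 2, Bornology.IsBounded A.domain ∧ Bornology.IsBounded B.domain ∧
        (∀ v ∈ A.domain, A.integrand v = 1) ∧ (∀ v ∈ B.domain, B.integrand v = 1) ∧
        y - (KZ.of A - KZ.of B) ∈ KZ.relations := by
  intro y hy
  induction hy using AddSubgroup.closure_induction with
  | mem x hx =>
    rcases hx with (⟨s, rfl⟩ | ⟨s, rfl⟩) | ⟨s, hsb, hs1, rfl⟩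
    · exact exists_planarPair_of_sign s exists_planar_sub_mem_relations_zero
    · exact exists_planarPair_of_sign s exists_planar_sub_mem_relations_one
    · refine ⟨s, KZ.IntegralRep.empty 2, hsb, by simp, hs1, by simp, ?_⟩
      have : KZ.of s - (KZ.of s - KZ.of (KZ.IntegralRep.empty 2)) =
          KZ.of (KZ.IntegralRep.empty 2) := by
        abel
      rw [this]
      exact KZ.IntegralRep.of_empty_mem_relations
  | zero =>
    refine ⟨KZ.IntegralRep.empty 2, KZ.IntegralRep.empty 2, by simp, by simp, by simp, by simp, ?_⟩
    simp
  | add x y _ _ hx hy =>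
    obtain ⟨A₁, B₁, hA₁b, hB₁b, hA₁1, hB₁1, e₁⟩ := hx
    obtain ⟨A₂, B₂, hA₂b, hB₂b, hA₂1, hB₂1, e₂⟩ := hy
    obtain ⟨A, hAb, hA1, eA⟩ := KZ.exists_merge₂ A₁ A₂ hA₁b hA₂b hA₁1 hA₂1
    obtain ⟨B, hBb, hB1, eB⟩ := KZ.exists_merge₂ B₁ B₂ hB₁b hB₂b hB₁1 hB₂1
    refine ⟨A, B, hAb, hBb, hA1, hB1, ?_⟩
    have : x + y - (KZ.of A - KZ.of B) =
        (x - (KZ.of A₁ - KZ.of B₁)) + (y - (KZ.of A₂ - KZ.of B₂)) +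
          (KZ.of A₁ + KZ.of A₂ - KZ.of A) - (KZ.of B₁ + KZ.of B₂ - KZ.of B) := by
      abel
    rw [this]
    exact KZ.relations.sub_mem (KZ.relations.add_mem (KZ.relations.add_mem e₁ e₂) eA) eB
  | neg x _ hx =>
    obtain ⟨A, B, hAb, hBb, hA1, hB1, e⟩ := hx
    refine ⟨B, A, hBb, hAb, hB1, hA1, ?_⟩
    have : -x - (KZ.of B - KZ.of A) = -(x - (KZ.of A - KZ.of B)) := by abel
    rw [this]
    exact KZ.relations.neg_mem e

end Summit.KontsevichZagierPeriods.ComplexOrientations.OrientationKernel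

end
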